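import Summits.BirchSwinnertonDyer.BirchSwinnertonDyer.Theorems.AdditiveBranchIMCTameMultiplicativeLine
import Summits.BirchSwinnertonDyer.BirchSwinnertonDyer.Theorems.AdditiveBranchIMCTameNoFixedPoints
import Summits.BirchSwinnertonDyer.BirchSwinnertonDyer.Theorems.AdditiveBranchIMCGreenbergVatsalResidualBranchTransport
import Summits.BirchSwinnertonDyer.Rank1Residual.Additive.RamifiedOrdinaryLineTransport
import Literature.NumberTheory.EllipticCurves.IsogenyQuadraticTwistProofs
import HarnessLib

/-!
# Route `AdditiveBranchIMC` (rung K1), cruxes 19357 `GordTwoRankZeroOffCaseOne` / 19358 `GordTwoRankOne` /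
# 19359 `MultLower`, registered stubs `stub_tameLocalVanishing{R0,M}` / `stub_localVanishing`: the
# CELL-FREE heart of the TAME MIRACLE at ℚ-level — a `p*`-twist of a curve with a «line» at `p` has no
# `p`-power torsion fixed by an element `τ` with `χ̄_p(τ)` a non-square `≠ −1`

Cell `bsd-addord`, LEAD seat `cruxlead-19357` (gen 7). THEOREMS ONLY (no definition, no named fact, no
`sorry`). The one cell-specific input of the three tame lines' local stub (LeadReport13 §3;
`Cruxes/GordTwoRankOne/PenNote2.md` §2) is a «line» of the PARTNER `V` (`E ≅ V^{(p*)}`): a point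
`v₀ ≠ 0` of `V[p]` with `τ x − x ∈ ℤ v₀` for all `x ∈ V[p]` — supplied on the (G-ord, `e = 2`) cell by
Serre's ordinary line (`MatarNekovar2019.exists_ordinaryLine`, `V` good ordinary at `p`) and on the (M)
cell by the Tate line (`TameMultiplicativeLine.exists_line_of_hasMultiplicativeReductionAtPrime`, `V`
multiplicative at `p`). GIVEN such a line for ONE `τ ∈ Γ_ℚ` whose mod-`p` cyclotomic character
`g = χ̄_p(τ)` is a NON-SQUARE with `g ≠ −1` (both exist once `p ≥ 5`: `exists_units_nonsquare_ne_neg_one`),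
this file proves, for every model `W = C • V^{(p*)}`:

* `torsion_eq_zero_of_smul_eq` — `W[p]^τ = 0`: along the signed twisting isomorphism
  `e : V(ℚ̄) ≃ W(ℚ̄)` (`Additive.exists_addEquiv_geomPoints_of_model_twist_sign`; `τ √p* = −√p*` because
  `χ̄_p(τ)` is a non-square, `ite_smul_geomSqrt_pStar_eq_quadraticChar`) a `τ`-fixed `P ∈ W[p]` pulls back
  to `x ∈ V[p]` with `τ x = −x`; then `−2x ∈ ℤ v₀`, so `x ∈ ℤ v₀` (`p` odd), so `τ x = g x`
  (`TameMultiplicativeLine.smul_eq_of_line`: the line character is `χ̄_p`), whence `(g + 1) x = 0` and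
  `x = 0` as `g ≠ −1`;
* `primary_eq_zero_of_smul_eq` — `W[p^∞]^τ = 0` (`TameNoFixedPoints.fixed_eq_zero_of_pPrimary`).

The eigenvalues of `τ` on `W[p]` are `−g` and `−1` (LeadReport12 §3); at `p = 3` the only non-square is
`g = −1` and the statement fails, consistently with `TameRoadRow`'s `5 ≤ p`.

References: J.-P. Serre, Invent. Math. 15 (1972) §1.11–1.12; J. H. Silverman, *AEC* (2009) X.5 Cor. 5.4
(the twisting isomorphism); K. Ireland, M. Rosen, GTM 84 (1990) Prop. 6.3.2 (`τ√p* = (χ̄_p(τ)/p)√p*`).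
-/

set_option linter.dupNamespace false
set_option autoImplicit false

noncomputable section

open scoped Classical

open NumberField IsDedekindDomain Field WeierstrassCurve
  Literature.NumberTheory.EllipticCurves Literature.NumberTheory.GaloisRepresentations
  Summit.BirchSwinnertonDyer.BirchSwinnertonDyer.Theorems.AdditiveBranchIMCGreenbergVatsalResidualBranchTransport

namespace Summit.BirchSwinnertonDyer.BirchSwinnertonDyer.Theorems.TameTwistedLine

variable {p : ℕ} [hp : Fact p.Prime]

/-! ### §1 The scalar: a non-square unit `g ≠ −1` of `𝔽_p` (`p ≥ 5`) -/

/-- For `p ≥ 5` there is a unit `g` of `𝔽_p` which is a NON-SQUARE (`(g/p) = −1`) and `≠ −1`: take any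
non-square `a` (Mathlib `quadraticChar_exists_neg_one`); if `a = −1` replace it by `4a = −4`, still a
non-square, and `−4 ≠ −1` as `p ≠ 3`. [folklore] [cite: IrelandRosen1990, Ch. 5 §1 (half the units are non-residues)] -/
theorem exists_units_nonsquare_ne_neg_one (hp5 : 5 ≤ p) :
    ∃ g : (ZMod p)ˣ, quadraticChar (ZMod p) (g : ZMod p) = -1 ∧ (g : ZMod p) ≠ -1 := by
  have hpr : p.Prime := hp.out
  have hp2 : p ≠ 2 := by omega
  have hp3 : p ≠ 3 := by omega
  have hF : ringChar (ZMod p) ≠ 2 := by rw [ZMod.ringChar_zmod_n]; exact hp2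
  obtain ⟨a, ha⟩ := quadraticChar_exists_neg_one hF
  have ha0 : a ≠ 0 := by
    rintro rfl
    rw [quadraticChar_zero] at ha
    norm_num at ha
  by_cases ha1 : a = -1
  · -- use `-4 = 4 • a`
    have h4 : (4 : ZMod p) ≠ 0 := by
      intro h
      have h' : ((4 : ℕ) : ZMod p) = 0 := by exact_mod_cast h
      rw [ZMod.natCast_eq_zero_iff] at h'
      have := Nat.le_of_dvd (by norm_num) h'
      omega
    have h40 : (4 : ZMod p) * a ≠ 0 := mul_ne_zero h4 ha0
    refine ⟨Units.mk0 _ h40, ?_, ?_⟩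
    · rw [Units.val_mk0, map_mul, show (4 : ZMod p) = 2 ^ 2 by norm_num,
        quadraticChar_sq_one' (by intro h; apply h4; rw [show (4 : ZMod p) = 2 ^ 2 by norm_num, h]; ring),
        one_mul, ha]
    · rw [Units.val_mk0, ha1]
      intro h
      have h3 : (3 : ZMod p) = 0 := by linear_combination -h
      have h' : ((3 : ℕ) : ZMod p) = 0 := by exact_mod_cast h3
      rw [ZMod.natCast_eq_zero_iff] at h'
      have := Nat.le_of_dvd (by norm_num) h'
      omega
  · exact ⟨Units.mk0 a ha0, by rw [Units.val_mk0]; exact ha, by rw [Units.val_mk0]; exact ha1⟩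

/-! ### §2 No fixed `p`-torsion on the twist -/

section Twist

variable (V W : WeierstrassCurve ℚ) [V.IsElliptic]

/-- **`W[p]^τ = 0` for a `p*`-twist `W = C • V^{(p*)}` of a curve with a line at `τ`.** Let `p` be an
odd prime, `τ ∈ Γ_ℚ` with `χ̄_p(τ)` a non-square `≠ −1`, and `v₀ ≠ 0` in `V[p]` with `τ x − x ∈ ℤ v₀`
for every `x ∈ V[p]`. Then every `τ`-fixed point of `W[p]` is `0`. (`τ√p* = −√p*`; a fixed `P` pulls
back along the signed twisting isomorphism to `x ∈ V[p]` with `τx = −x`, so `−2x ∈ ℤ v₀`, `x ∈ ℤ v₀`,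
`τ x = χ̄_p(τ) x`, `(χ̄_p(τ) + 1) x = 0`, `x = 0`.) [cite: Serre1972, §1.11–1.12]
[cite: SilvermanAEC2009, X.5 Cor. 5.4] -/
theorem torsion_eq_zero_of_smul_eq (hp2 : p ≠ 2)
    (hVW : ∃ C : VariableChange ℚ, C • V.quadraticTwist ((-1 : ℚ) ^ (p / 2) * p) = W)
    {τ : absoluteGaloisGroup ℚ}
    (hχ : quadraticChar (ZMod p) ((modPCyclotomicCharacterZMod ℚ p τ : (ZMod p)ˣ) : ZMod p) = -1)
    (hne : ((modPCyclotomicCharacterZMod ℚ p τ : (ZMod p)ˣ) : ZMod p) ≠ -1)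
    {v₀ : geomTorsion V (p : ℤ)} (hv₀ : v₀ ≠ 0)
    (hline : ∀ x : geomTorsion V (p : ℤ), ∃ n : ℤ, τ • x - x = n • v₀)
    {P : geomTorsion W (p : ℤ)} (hP : τ • P = P) : P = 0 := by
  have hpr : p.Prime := hp.out
  haveI : NeZero (p : ℚ) := ⟨by exact_mod_cast hpr.ne_zero⟩
  set d : ℚ := (-1 : ℚ) ^ (p / 2) * p with hd
  have hd0 : d ≠ 0 := mul_ne_zero (pow_ne_zero _ (by norm_num)) (by exact_mod_cast hpr.ne_zero)
  -- `τ √p* = −√p*`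
  have hsgn := ite_smul_geomSqrt_pStar_eq_quadraticChar (p := p) hp2 τ
  rw [← modPCyclotomicCharacterZMod_eq_modNCyclotomicCharacter, hχ] at hsgn
  have hτd : ¬ τ • geomSqrt d = geomSqrt d := by
    intro h
    rw [hd] at h
    rw [if_pos h] at hsgn
    norm_num at hsgn
  have hneg : τ • geomSqrt d = -geomSqrt d :=
    (map_geomSqrt (absoluteGaloisGroup.toAlgEquiv ℚ τ) d).resolve_left hτd
  -- the signed twisting isomorphism `e : V(ℚ̄) ≃ W(ℚ̄)`
  obtain ⟨e, -, heneg⟩ := Summit.BirchSwinnertonDyer.Rank1Residual.Additive.exists_addEquiv_geomPoints_of_model_twist_sign V hd0 hVW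
  -- pull `P` back to `x ∈ V[p]` with `τ x = −x`
  set x : geomPoints V := e.symm (P : geomPoints W) with hx
  have hex : e x = (P : geomPoints W) := by rw [hx, e.apply_symm_apply]
  have hPfix : τ • (P : geomPoints W) = P := by
    rw [← AddSubgroup.torsionBy.coe_smul, hP]
  have hτx : τ • x = -x := by
    apply e.injective
    have h1 := heneg τ hneg x
    -- `e (τ • x) = -(τ • e x) = -P = e (-x)`
    rw [hex, hPfix] at h1
    rw [h1, map_neg, hex]
  -- `x` is `p`-torsion
  have hPp : (p : ℤ) • (P : geomPoints W) = 0 := (Submodule.mem_torsionBy_iff _ _).mp P.2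
  have hxp : (p : ℤ) • x = 0 := by
    rw [hx, ← map_zsmul, hPp, map_zero]
  set x' : geomTorsion V (p : ℤ) := ⟨x, (Submodule.mem_torsionBy_iff _ _).mpr hxp⟩ with hx'
  have hτx' : τ • x' = -x' := Subtype.ext (by
    rw [AddSubgroup.torsionBy.coe_smul]
    exact hτx)
  have hkill : ∀ y : geomTorsion V (p : ℤ), (p : ℤ) • y = 0 := fun y ↦ by
    have hy : p • (y : geomPoints V) = 0 := AddSubgroup.torsionBy.nsmul_iff.mp y.2
    rw [natCast_zsmul]
    exact Subtype.ext (by rw [AddSubmonoidClass.coe_nsmul, ZeroMemClass.coe_zero]; exact hy)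
  -- `x' ∈ ℤ v₀`: `−2 x' = n v₀` and `2` is invertible modulo `p`
  obtain ⟨n, hn⟩ := hline x'
  rw [hτx', show -x' - x' = (-2 : ℤ) • x' by
    rw [neg_smul, two_smul, neg_add]; abel] at hn
  -- `p = 2t - 1` with `t = (p+1)/2`; so `x' = (2t) • x' = -t • (−2 • x') = (−t n) • v₀`
  obtain ⟨k, hk⟩ := hpr.odd_of_ne_two hp2
  have hx'v : x' = (-(((k : ℤ) + 1) * n)) • v₀ := by
    have h2 : (2 * ((k : ℤ) + 1)) • x' = x' := by
      have : (2 * ((k : ℤ) + 1)) = (p : ℤ) + 1 := by push_cast [hk]; ring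
      rw [this, add_smul, hkill, one_smul, zero_add]
    calc x' = (2 * ((k : ℤ) + 1)) • x' := h2.symm
      _ = (-((k : ℤ) + 1)) • ((-2 : ℤ) • x') := by rw [← mul_smul]; congr 1; ring
      _ = (-(((k : ℤ) + 1) * n)) • v₀ := by rw [hn, ← mul_smul]; congr 1; ring
  set m : ℤ := -(((k : ℤ) + 1) * n) with hm
  -- the line character: `τ v₀ = a v₀`, `a ≡ χ̄_p(τ)`
  set a : ℤ := ((((modPCyclotomicCharacterZMod ℚ p τ : (ZMod p)ˣ) : ZMod p)).val : ℤ) with ha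
  have hacast : ((a : ℤ) : ZMod p) = ((modPCyclotomicCharacterZMod ℚ p τ : (ZMod p)ˣ) : ZMod p) := by
    rw [ha, Int.cast_natCast, ZMod.natCast_zmod_val]
  have hτv₀ : τ • v₀ = a • v₀ := TameMultiplicativeLine.smul_eq_of_line V hv₀ hline hacast
  -- `τ x' = a x'` and `τ x' = -x'`, so `(a + 1) x' = 0`
  have hτx'a : τ • x' = a • x' := by
    rw [hx'v, smul_comm τ m v₀, hτv₀, smul_comm a m v₀]
  have hsum : (a + 1) • x' = 0 := by
    rw [add_smul, one_smul, ← hτx'a, hτx', neg_add_cancel]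
  -- `a + 1` is prime to `p`
  have hndvd : ¬ (p : ℤ) ∣ a + 1 := by
    intro hdvd
    apply hne
    rw [← hacast]
    have h0 : ((a + 1 : ℤ) : ZMod p) = 0 := (ZMod.intCast_zmod_eq_zero_iff_dvd _ p).mpr hdvd
    push_cast at h0
    linear_combination h0
  have hcop : IsCoprime (a + 1) (p : ℤ) := by
    rw [Int.isCoprime_iff_gcd_eq_one, Int.gcd_comm]
    have h1 : Nat.Coprime p (a + 1).natAbs :=
      (Nat.Prime.coprime_iff_not_dvd hpr).mpr (fun h ↦ hndvd (Int.natCast_dvd.mpr h))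
    have h2 : Int.gcd (p : ℤ) (a + 1) = Nat.gcd p (a + 1).natAbs := by simp [Int.gcd]
    rw [h2]
    exact h1
  -- Bézout: `x' = (u (a+1) + v p) • x' = 0`
  have hx'0 : x' = 0 := by
    obtain ⟨u, w, huw⟩ := hcop
    calc x' = (1 : ℤ) • x' := (one_smul ℤ x').symm
      _ = (u * (a + 1) + w * (p : ℤ)) • x' := by rw [huw]
      _ = 0 := by rw [add_smul, mul_smul, mul_smul, hsum, hkill, smul_zero, smul_zero, add_zero]
  -- back to `P`
  have hx0 : x = 0 := congrArg Subtype.val hx'0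
  apply Subtype.ext
  rw [ZeroMemClass.coe_zero, ← hex, hx0, map_zero]

/-- **`W[p^∞]^τ = 0`**, the `p`-primary form of `torsion_eq_zero_of_smul_eq` (same hypotheses): a
`τ`-fixed point of `W[p^∞]` of order `p^{k+1}` would give the `τ`-fixed point `p^k·x ≠ 0` of `W[p]`
(`TameNoFixedPoints.fixed_eq_zero_of_pPrimary`). [cite: Serre1972, §1.11–1.12] -/
theorem primary_eq_zero_of_smul_eq (hp2 : p ≠ 2)
    (hVW : ∃ C : VariableChange ℚ, C • V.quadraticTwist ((-1 : ℚ) ^ (p / 2) * p) = W)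
    {τ : absoluteGaloisGroup ℚ}
    (hχ : quadraticChar (ZMod p) ((modPCyclotomicCharacterZMod ℚ p τ : (ZMod p)ˣ) : ZMod p) = -1)
    (hne : ((modPCyclotomicCharacterZMod ℚ p τ : (ZMod p)ˣ) : ZMod p) ≠ -1)
    {v₀ : geomTorsion V (p : ℤ)} (hv₀ : v₀ ≠ 0)
    (hline : ∀ x : geomTorsion V (p : ℤ), ∃ n : ℤ, τ • x - x = n • v₀)
    {m : geomPrimaryTorsion W p} (hm : τ • m = m) : m = 0 := by
  refine TameNoFixedPoints.fixed_eq_zero_of_pPrimary (p := p) (M := geomPrimaryTorsion W p)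
    (fun y ↦ ?_) τ (fun y hy hτy ↦ ?_) hm
  · obtain ⟨k, hk⟩ := y.2
    exact ⟨k, Subtype.ext (by rw [AddSubmonoidClass.coe_nsmul, ZeroMemClass.coe_zero]; exact hk)⟩
  · -- `y ∈ W[p]` is `τ`-fixed, hence `0`
    have hyp : (p : ℤ) • (y : geomPoints W) = 0 := by
      rw [natCast_zsmul, ← AddSubmonoidClass.coe_nsmul, hy, ZeroMemClass.coe_zero]
    set y' : geomTorsion W (p : ℤ) := ⟨y, (Submodule.mem_torsionBy_iff _ _).mpr hyp⟩ with hy'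
    have hτy' : τ • y' = y' := Subtype.ext (by
      rw [AddSubgroup.torsionBy.coe_smul]
      change τ • (y : geomPoints W) = y
      rw [← primaryComponent.coe_smul, hτy])
    have h0 := torsion_eq_zero_of_smul_eq V W hp2 hVW hχ hne hv₀ hline hτy'
    have h0' : (y : geomPoints W) = 0 := congrArg Subtype.val h0
    exact Subtype.ext h0'

end Twist

end Summit.BirchSwinnertonDyer.BirchSwinnertonDyer.Theorems.TameTwistedLine

end
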